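import Summits.QuantumFields.BalabanUV.Beta.EriceRemainderEnclosureHistoryAutonomyFunctionalShiftLargeLimit
import Summits.QuantumFields.BalabanUV.Beta.EriceRemainderEnclosureHistoryAutonomyMonotoneGeneral

/-!
# EriceRemainderEnclosureHistoryAutonomyFunctionalShiftLargeSeparation — (E52g) THE RELATIVE Λ-PARAMETER SEPARATES THE TRAJECTORIES OF ONE FLOW — ANY SIZE OF THE
# MEMORY, ANY PINS: for `B` with a zeroth moment `M` OF ANY SIZE and a floor `b > 0` on ]0,γ]^ℕ and ANY two box solutions `h` (pin `p`) and `h′` (pin `p′`) of its flow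
# with memory, the level offset `D_j = 1∕h_j² − 1∕h′_j²` is transported DOWNWARDS with a multiplicative loss only — `|D_j| ≤ e^{3M∕(2b√b)}·sup_{i≥n} |D_i|` for every `n`
# ((E43b)'s downward contraction, now for two pins under the envelope of the larger one) — so with the relative Λ-parameter `δ_∞ = lim D_j` of (E52c):
# `|1∕h_j² − 1∕h′_j²| ≤ e^{3M∕(2b√b)}·|δ_∞|` at EVERY scale, in particular `|1∕p² − 1∕p′²| ≤ e^{3M∕(2b√b)}·|δ_∞|`; hence `δ_∞ = 0 ⟺ h = h′`, distinct pins give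
# `δ_∞ ≠ 0` (two continuum trajectories NEVER merge in the `1∕g²` variable), and `u ↦ δ_∞(u, h₀)` is INJECTIVE on the set of ALL box solutions from ALL pins —
# (E44a)'s classification (one pin) and (E48g)'s `lim_pos` (ordered pins, uniqueness regime) without either restriction

Cell `pub-balaban`, β-function sub-cell, BINDER row D4 «RemainderConst leaves for Bałaban's split» (`HOME/BINDER-OWNERS.md`; owner lineage `b2b-balaban-beta-an4`;
this file by co-owner #2 lineage `b2b-balaban-beta-d4-p2`, generation 48), β-FLOW TEAM duty (1), FREEZE (0) honoured (def-free; node U2's `MemFlow` ∕ `SeqBox` ∕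
`seqBox_shift` ∕ `Sharpness.abs_sub_le_half_cube_mul` ∕ `one_div_sqrt_anti`, (E43b)'s `prod_le_exp` ∕ `prod_Ico_le_prod_Ico_of_one_le`, (E52a)'s `le_envelope_of_le_pin`,
(E52b)'s `exists_threshold_scale`, (E52c)'s `exists_tendsto_disc_large_init` BY NAME, nothing restated).  Sequel of (E52c) `…FunctionalShiftLargeLimit` (existence of
`δ_∞` for any `M` and any pins) and of (E43b)∕(E44a) `…MonotoneGeneral` ∕ `…AsymptoticDiscrepancy` (the downward contraction and the classification for ONE pin).

HONEST FRAMING (page 1, verbatim and binding).  *"Discharging BetaPertH makes Bałaban's UV stability UNCONDITIONAL — a real constructive-QFT result; it is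
NOT the continuum limit and NOT the Clay problem."*  THIS FILE DISCHARGES NOTHING OF THE KIND.  Elementary real analysis (a downward induction with a convergent
product) about an ABSTRACT functional on ]0,γ]^ℕ — hypotheses, not facts; nothing of Bałaban's (1.22) is asserted; the size of the zeroth moment of its limit
functional is NOT PRINTED ([I] p. 298; GAPS G-t4-U2-1∕-2).  Row D4 class UNCHANGED (critical-path width 0; instance 0∕1; D4 DISCHARGE NO DATE).  HONEST DEPENDENCY:
continuum YM on T⁴ ⇐ BetaPertH ∧ nine spine estimates (0/9 proved); BetaPertH ⇐ (D1) ∧ (D4) ∧ CAP+tail; G-an2-4 gates asym, D1 and NE2/3/4.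

THE POINT (census sense (α); the solution space of one flow across ALL pins).  (E44a) classified the box solutions of one flow from ONE pin by the asymptotic
discrepancy (`D_∞ = 0 ⟺ h = h′`, injectivity of `h ↦ D_∞(h, h₀)`); (E48g) proved non-merging across two pins under uniqueness and order.  With (E52c) the
relative Λ-parameter `δ_∞(h, h′)` exists for ANY two box solutions from ANY pins and ANY `M`; here the downward contraction of (E43b) — which needs only the zeroth
moment and the floor envelope, NO smallness — is rerun under the envelope of the larger pin (§§1–2), giving `sup_j |D_j| ≤ e^{3M∕(2b√b)}·|δ_∞|` (§3).  So (§4) the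
single number `δ_∞` controls the offset at every scale, from the infrared level offset `|1∕p² − 1∕p′²| ≤ e^{3M∕(2b√b)}·|δ_∞|` upwards; `δ_∞ = 0` forces `h = h′` (and
`p = p′`); and the relative Λ-parameter against any reference solution is INJECTIVE on all box solutions from all pins — in the language of the running coupling:
the continuum trajectories of one flow with memory, of any size and whether or not the flow determines them from their pins, are CLASSIFIED by one real number,
their relative Λ-parameter, and two of them never merge in the ultraviolet.  Two-sided: `e^{−3M∕(2b√b)}·|1∕p² − 1∕p′²| ≤ |δ_∞| ≤ 2e^{6M∕(b√b)}·(|1∕p² − 1∕p′²| +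
2M√m₀∕√b)` ((E52c)).  NOT claimed: surjectivity onto an interval, continuity in the pins beyond (E44a)∕(E47), anything printed.

WHAT IS PROVED ([folklore]; 0 `def`, 0 sorry).  §1 `abs_sub_le_half_cube_disc_two_pins`.  §2 **`abs_disc_le_mul_prod_of_tail_two_pins`**, `abs_disc_le_exp_mul_of_tail_two_pins`.
§3 **`abs_disc_le_exp_mul_abs_lim_two_pins`**, **`abs_init_le_exp_mul_abs_lim`**.  §4 **`eq_of_tendsto_disc_zero_two_pins`**, `pin_eq_of_tendsto_disc_zero`,
**`lim_ne_zero_of_pin_ne`**, **`injOn_relativeLambda`**.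
-/

noncomputable section
open Filter Topology Finset

namespace Summit.QuantumFields.BalabanUV.Beta.EriceRemainderEnclosureHistoryAutonomyFunctionalShiftLargeSeparation

open Literature.MathematicalPhysics.QuantumFieldTheory.Balaban1983to89
open Literature.MathematicalPhysics.QuantumFieldTheory.Balaban1983to89.T4BetaStationary
open Literature.MathematicalPhysics.QuantumFieldTheory.Balaban1983to89.T4BetaFlowWellPosed
open Literature.MathematicalPhysics.QuantumFieldTheory.Balaban1983to89.T4BetaFlowWellPosed.Sharpness (abs_sub_le_half_cube_mul)
open Summit.QuantumFields.BalabanUV.Beta.EriceRemainderEnclosureHistoryAutonomyMonotoneGeneral (prod_le_exp prod_Ico_le_prod_Ico_of_one_le)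
open Summit.QuantumFields.BalabanUV.Beta.EriceRemainderEnclosureHistoryAutonomyFunctionalShift (envelope_pos)
open Summit.QuantumFields.BalabanUV.Beta.EriceRemainderEnclosureHistoryAutonomyFunctionalShiftTwoPins (le_envelope_of_le_pin)
open Summit.QuantumFields.BalabanUV.Beta.EriceRemainderEnclosureHistoryAutonomyFunctionalShiftLarge (exists_threshold_scale)
open Summit.QuantumFields.BalabanUV.Beta.EriceRemainderEnclosureHistoryAutonomyFunctionalShiftLargeLimit (exists_tendsto_disc_large_init)

variable {B : (ℕ → ℝ) → ℝ} {M γ b p p' P : ℝ} {h h' h₀ : ℕ → ℝ}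

/-! ## §1 The half-cube sensitivity under the envelope of the larger pin -/

/-- `|h_i − h′_i| ≤ (c_i³∕2)·|1∕h_i² − 1∕h′_i²|`, `c_i = (1∕P² + i·b)^{−1∕2}`, for box solutions from pins `p, p′ ≤ P` (pure algebra on two numbers below `c_i`). [folklore] -/
theorem abs_sub_le_half_cube_disc_two_pins (hb : 0 < b) (hp : 0 < p) (hpP : p ≤ P) (hp' : 0 < p') (hp'P : p' ≤ P)
    (hlo : ∀ u, SeqBox γ u → b ≤ B u) (hh : SeqBox γ h) (hh' : SeqBox γ h') (hf : MemFlow B p h) (hf' : MemFlow B p' h') (i : ℕ) :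
    |h i - h' i| ≤ (1 / Real.sqrt (1 / P ^ 2 + (i : ℝ) * b)) ^ 3 / 2 * |1 / h i ^ 2 - 1 / h' i ^ 2| :=
  abs_sub_le_half_cube_mul (hh i).1 (hh' i).1 (le_envelope_of_le_pin hb hp hpP hlo hh hf i)
    (le_envelope_of_le_pin hb hp' hp'P hlo hh' hf' i)

/-! ## §2 The downward contraction for two pins -/

/-- **THE DOWNWARD CONTRACTION, TWO PINS** (ANY zeroth moment `M`, floor `b`): if two box solutions from pins `p, p′ ≤ P` have `|1∕h_i² − 1∕h′_i²| ≤ η` for every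
`i ≥ n`, then at EVERY scale `j`, `|1∕h_j² − 1∕h′_j²| ≤ η·Π_{l∈[j,n)} (1 + (M∕2)·c_{l+1}³)`, `c_i = (1∕P² + i·b)^{−1∕2}` ((E43b) `abs_disc_le_mul_prod_of_tail` had one pin).
[folklore] -/
theorem abs_disc_le_mul_prod_of_tail_two_pins
    (hB : ∀ u u' : ℕ → ℝ, SeqBox γ u → SeqBox γ u' → ∀ D : ℝ, (∀ j, |u j - u' j| ≤ D) → |B u - B u'| ≤ M * D)
    (hM : 0 ≤ M) (hb : 0 < b) (hp : 0 < p) (hpP : p ≤ P) (hp' : 0 < p') (hp'P : p' ≤ P) (hlo : ∀ u, SeqBox γ u → b ≤ B u)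
    (hh : SeqBox γ h) (hh' : SeqBox γ h') (hf : MemFlow B p h) (hf' : MemFlow B p' h') {n : ℕ} {η : ℝ}
    (hη0 : 0 ≤ η) (htail : ∀ i, n ≤ i → |1 / h i ^ 2 - 1 / h' i ^ 2| ≤ η) :
    ∀ j, |1 / h j ^ 2 - 1 / h' j ^ 2|
      ≤ η * ∏ l ∈ Ico j n, (1 + M / 2 * (1 / Real.sqrt (1 / P ^ 2 + ((l : ℝ) + 1) * b)) ^ 3) := by
  have hP : 0 < P := hp.trans_le hpP
  set f : ℕ → ℝ := fun l => 1 + M / 2 * (1 / Real.sqrt (1 / P ^ 2 + ((l : ℝ) + 1) * b)) ^ 3 with hfdef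
  have hf1 : ∀ l, 1 ≤ f l := fun l => by
    have : 0 ≤ M / 2 * (1 / Real.sqrt (1 / P ^ 2 + ((l : ℝ) + 1) * b)) ^ 3 := by positivity
    simp only [hfdef]; linarith
  -- downward induction: the bound holds at every `j ≥ n − k`
  have key : ∀ k : ℕ, ∀ j, n - k ≤ j → |1 / h j ^ 2 - 1 / h' j ^ 2| ≤ η * ∏ l ∈ Ico j n, f l := by
    intro k
    induction k with
    | zero =>
      intro j hj
      rw [Nat.sub_zero] at hj
      rw [Ico_eq_empty_of_le hj, prod_empty, mul_one]
      exact htail j hj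
    | succ k ih =>
      intro j hj
      by_cases hj' : n - k ≤ j
      · exact ih j hj'
      · have hjn : j < n := by omega
        set Q := ∏ l ∈ Ico (j + 1) n, f l with hQ
        have hQge : ∀ i, j + 1 ≤ i → ∏ l ∈ Ico i n, f l ≤ Q := fun i hi => prod_Ico_le_prod_Ico_of_one_le hf1 hi n
        have hQ0 : 0 ≤ Q := prod_nonneg fun l _ => (zero_le_one.trans (hf1 l))
        have habove : ∀ i, j + 1 ≤ i → |1 / h i ^ 2 - 1 / h' i ^ 2| ≤ η * Q := fun i hi =>
          (ih i (by omega)).trans (mul_le_mul_of_nonneg_left (hQge i hi) hη0)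
        -- the histories above `j+1` are `(c_{j+1}³∕2)·ηQ`-close
        set c := 1 / Real.sqrt (1 / P ^ 2 + ((j : ℝ) + 1) * b) with hc
        have hclose : ∀ i, |h (j + 1 + i) - h' (j + 1 + i)| ≤ c ^ 3 / 2 * (η * Q) := by
          intro i
          have h1 := abs_sub_le_half_cube_disc_two_pins hb hp hpP hp' hp'P hlo hh hh' hf hf' (j + 1 + i)
          have hci : (1 / Real.sqrt (1 / P ^ 2 + ((j + 1 + i : ℕ) : ℝ) * b)) ^ 3 ≤ c ^ 3 := by
            refine pow_le_pow_left₀ (by positivity) (one_div_sqrt_anti (by positivity) ?_) 3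
            push_cast; nlinarith [(Nat.cast_nonneg i : (0 : ℝ) ≤ i)]
          exact h1.trans (mul_le_mul (div_le_div_of_nonneg_right hci (by norm_num)) (habove _ (by omega))
            (abs_nonneg _) (by positivity))
        -- one increment is one memory term
        have hstep : |(1 / h (j + 1) ^ 2 - 1 / h' (j + 1) ^ 2) - (1 / h j ^ 2 - 1 / h' j ^ 2)| ≤ M * (c ^ 3 / 2 * (η * Q)) := by
          have e : (1 / h (j + 1) ^ 2 - 1 / h' (j + 1) ^ 2) - (1 / h j ^ 2 - 1 / h' j ^ 2)
              = B (fun i => h (j + 1 + i)) - B (fun i => h' (j + 1 + i)) := by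
            rw [hf.2 j, hf'.2 j]; ring
          rw [e]
          exact hB _ _ (seqBox_shift hh (j + 1)) (seqBox_shift hh' (j + 1)) _ hclose
        have hDj1 := habove (j + 1) le_rfl
        rw [prod_eq_prod_Ico_succ_bot hjn]
        have := abs_sub_abs_le_abs_sub (1 / h j ^ 2 - 1 / h' j ^ 2) (1 / h (j + 1) ^ 2 - 1 / h' (j + 1) ^ 2)
        rw [abs_sub_comm] at hstep
        have e : η * (f j * Q) = η * Q + M * (c ^ 3 / 2 * (η * Q)) := by simp only [hfdef, hc]; ring
        rw [e]
        linarith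
  intro j
  exact key n j (by omega)

/-- … with (E43b)'s uniform bound on the transport factor: `|1∕h_j² − 1∕h′_j²| ≤ e^{3M∕(2b√b)}·η` at every scale. [folklore] -/
theorem abs_disc_le_exp_mul_of_tail_two_pins
    (hB : ∀ u u' : ℕ → ℝ, SeqBox γ u → SeqBox γ u' → ∀ D : ℝ, (∀ j, |u j - u' j| ≤ D) → |B u - B u'| ≤ M * D)
    (hM : 0 ≤ M) (hb : 0 < b) (hp : 0 < p) (hpP : p ≤ P) (hp' : 0 < p') (hp'P : p' ≤ P) (hlo : ∀ u, SeqBox γ u → b ≤ B u)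
    (hh : SeqBox γ h) (hh' : SeqBox γ h') (hf : MemFlow B p h) (hf' : MemFlow B p' h') {n : ℕ} {η : ℝ}
    (hη0 : 0 ≤ η) (htail : ∀ i, n ≤ i → |1 / h i ^ 2 - 1 / h' i ^ 2| ≤ η) (j : ℕ) :
    |1 / h j ^ 2 - 1 / h' j ^ 2| ≤ Real.exp (3 * M / (2 * (b * Real.sqrt b))) * η := by
  have := abs_disc_le_mul_prod_of_tail_two_pins hB hM hb hp hpP hp' hp'P hlo hh hh' hf hf' hη0 htail j
  rw [mul_comm]
  exact this.trans (mul_le_mul_of_nonneg_left (prod_le_exp hb hM P j n) hη0)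

/-! ## §3 The relative Λ-parameter controls the offset at every scale -/

/-- **NON-MERGING, LIMIT FORM, TWO PINS**: if `1∕h_m² − 1∕h′_m² → δ`, then `|1∕h_j² − 1∕h′_j²| ≤ e^{3M∕(2b√b)}·|δ|` at EVERY scale — for ANY `M` and ANY two box
solutions from pins `p, p′ ∈ ]0,γ]` (the limit exists by (E52c) `exists_tendsto_disc_large_init`). [folklore] -/
theorem abs_disc_le_exp_mul_abs_lim_two_pins
    (hB : ∀ u u' : ℕ → ℝ, SeqBox γ u → SeqBox γ u' → ∀ D : ℝ, (∀ j, |u j - u' j| ≤ D) → |B u - B u'| ≤ M * D)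
    (hM : 0 ≤ M) (hb : 0 < b) (hp : 0 < p) (hpγ : p ≤ γ) (hp' : 0 < p') (hp'γ : p' ≤ γ) (hlo : ∀ u, SeqBox γ u → b ≤ B u)
    (hh : SeqBox γ h) (hh' : SeqBox γ h') (hf : MemFlow B p h) (hf' : MemFlow B p' h') {d : ℝ}
    (hd : Tendsto (fun m => 1 / h m ^ 2 - 1 / h' m ^ 2) atTop (𝓝 d)) (j : ℕ) :
    |1 / h j ^ 2 - 1 / h' j ^ 2| ≤ Real.exp (3 * M / (2 * (b * Real.sqrt b))) * |d| := by
  set C : ℝ := Real.exp (3 * M / (2 * (b * Real.sqrt b))) with hC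
  have hC0 : 0 < C := Real.exp_pos _
  refine le_of_forall_pos_le_add fun ε hε => ?_
  have hε' : 0 < ε / C := div_pos hε hC0
  obtain ⟨n, hn⟩ := (Metric.tendsto_atTop.1 hd) (ε / C) hε'
  have htail : ∀ i, n ≤ i → |1 / h i ^ 2 - 1 / h' i ^ 2| ≤ |d| + ε / C := fun i hi => by
    have := hn i hi
    rw [Real.dist_eq] at this
    calc |1 / h i ^ 2 - 1 / h' i ^ 2| = |d + ((1 / h i ^ 2 - 1 / h' i ^ 2) - d)| := by ring_nf
      _ ≤ |d| + |(1 / h i ^ 2 - 1 / h' i ^ 2) - d| := abs_add_le _ _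
      _ ≤ |d| + ε / C := by linarith
  have := abs_disc_le_exp_mul_of_tail_two_pins hB hM hb hp hpγ hp' hp'γ hlo hh hh' hf hf' (by positivity) htail j
  have e : C * (|d| + ε / C) = C * |d| + ε := by field_simp
  linarith [e]

/-- **THE INFRARED LEVEL OFFSET IS DOMINATED BY THE RELATIVE Λ-PARAMETER**: `|1∕p² − 1∕p′²| ≤ e^{3M∕(2b√b)}·|δ_∞|` — scale `0` of the previous theorem; with
(E52c)'s `|δ_∞| ≤ 2e^{6M∕(b√b)}·(|1∕p² − 1∕p′²| + 2M√m₀∕√b)` the two numbers control each other up to `e^{O(M∕b^{3∕2})}` and the threshold constant. [folklore] -/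
theorem abs_init_le_exp_mul_abs_lim
    (hB : ∀ u u' : ℕ → ℝ, SeqBox γ u → SeqBox γ u' → ∀ D : ℝ, (∀ j, |u j - u' j| ≤ D) → |B u - B u'| ≤ M * D)
    (hM : 0 ≤ M) (hb : 0 < b) (hp : 0 < p) (hpγ : p ≤ γ) (hp' : 0 < p') (hp'γ : p' ≤ γ) (hlo : ∀ u, SeqBox γ u → b ≤ B u)
    (hh : SeqBox γ h) (hh' : SeqBox γ h') (hf : MemFlow B p h) (hf' : MemFlow B p' h') {d : ℝ}
    (hd : Tendsto (fun m => 1 / h m ^ 2 - 1 / h' m ^ 2) atTop (𝓝 d)) :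
    |1 / p ^ 2 - 1 / p' ^ 2| ≤ Real.exp (3 * M / (2 * (b * Real.sqrt b))) * |d| := by
  have := abs_disc_le_exp_mul_abs_lim_two_pins hB hM hb hp hpγ hp' hp'γ hlo hh hh' hf hf' hd 0
  rwa [hf.1, hf'.1] at this

/-! ## §4 The dichotomy and the classification across all pins -/

/-- **`δ_∞ = 0` FORCES EQUALITY — ANY `M`, ANY PINS**: if the level offset of two box solutions (from any two pins) tends to `0`, the solutions coincide. [folklore] -/
theorem eq_of_tendsto_disc_zero_two_pins
    (hB : ∀ u u' : ℕ → ℝ, SeqBox γ u → SeqBox γ u' → ∀ D : ℝ, (∀ j, |u j - u' j| ≤ D) → |B u - B u'| ≤ M * D)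
    (hM : 0 ≤ M) (hb : 0 < b) (hp : 0 < p) (hpγ : p ≤ γ) (hp' : 0 < p') (hp'γ : p' ≤ γ) (hlo : ∀ u, SeqBox γ u → b ≤ B u)
    (hh : SeqBox γ h) (hh' : SeqBox γ h') (hf : MemFlow B p h) (hf' : MemFlow B p' h')
    (hd : Tendsto (fun m => 1 / h m ^ 2 - 1 / h' m ^ 2) atTop (𝓝 0)) : h = h' := by
  funext j
  have h1 := abs_disc_le_exp_mul_abs_lim_two_pins hB hM hb hp hpγ hp' hp'γ hlo hh hh' hf hf' hd j
  rw [abs_zero, mul_zero] at h1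
  have h2 : 1 / h j ^ 2 = 1 / h' j ^ 2 := sub_eq_zero.1 (abs_nonpos_iff.1 h1)
  have h3 : h j ^ 2 = h' j ^ 2 := by
    have := congrArg (fun x : ℝ => 1 / x) h2
    simpa only [one_div_one_div] using this
  exact (pow_left_inj₀ (hh j).1.le (hh' j).1.le two_ne_zero).1 h3

/-- … in particular the pins coincide. [folklore] -/
theorem pin_eq_of_tendsto_disc_zero
    (hB : ∀ u u' : ℕ → ℝ, SeqBox γ u → SeqBox γ u' → ∀ D : ℝ, (∀ j, |u j - u' j| ≤ D) → |B u - B u'| ≤ M * D)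
    (hM : 0 ≤ M) (hb : 0 < b) (hp : 0 < p) (hpγ : p ≤ γ) (hp' : 0 < p') (hp'γ : p' ≤ γ) (hlo : ∀ u, SeqBox γ u → b ≤ B u)
    (hh : SeqBox γ h) (hh' : SeqBox γ h') (hf : MemFlow B p h) (hf' : MemFlow B p' h')
    (hd : Tendsto (fun m => 1 / h m ^ 2 - 1 / h' m ^ 2) atTop (𝓝 0)) : p = p' := by
  have := eq_of_tendsto_disc_zero_two_pins hB hM hb hp hpγ hp' hp'γ hlo hh hh' hf hf' hd
  rw [← hf.1, ← hf'.1, this]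

/-- **TWO CONTINUUM TRAJECTORIES FROM DIFFERENT PINS NEVER MERGE**: `p ≠ p′` ⟹ the relative Λ-parameter `δ_∞` (which exists, (E52c)) is `≠ 0` — for memory of ANY
size, with no uniqueness and no order assumed ((E48g) `lim_pos`: ordered pins in a uniqueness regime). [folklore] -/
theorem lim_ne_zero_of_pin_ne
    (hB : ∀ u u' : ℕ → ℝ, SeqBox γ u → SeqBox γ u' → ∀ D : ℝ, (∀ j, |u j - u' j| ≤ D) → |B u - B u'| ≤ M * D)
    (hM : 0 ≤ M) (hb : 0 < b) (hp : 0 < p) (hpγ : p ≤ γ) (hp' : 0 < p') (hp'γ : p' ≤ γ) (hlo : ∀ u, SeqBox γ u → b ≤ B u)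
    (hh : SeqBox γ h) (hh' : SeqBox γ h') (hf : MemFlow B p h) (hf' : MemFlow B p' h') (hpp' : p ≠ p') {d : ℝ}
    (hd : Tendsto (fun m => 1 / h m ^ 2 - 1 / h' m ^ 2) atTop (𝓝 d)) : d ≠ 0 := by
  intro hd0
  rw [hd0] at hd
  exact hpp' (pin_eq_of_tendsto_disc_zero hB hM hb hp hpγ hp' hp'γ hlo hh hh' hf hf' hd)

/-- **THE RELATIVE Λ-PARAMETER CLASSIFIES ALL BOX SOLUTIONS FROM ALL PINS**: for a reference box solution `h₀` (pin `p₀ ∈ ]0,γ]`) of the flow of `B` (zeroth moment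
`M` of ANY size, floor `b`), the map `u ↦ lim_m (1∕u_m² − 1∕h₀_m²)` is INJECTIVE on `{u | SeqBox γ u ∧ ∃ p ∈ ]0,γ], MemFlow B p u}` ((E44a) `injOn_limUnder`: one pin).
[folklore] -/
theorem injOn_relativeLambda {p₀ : ℝ}
    (hB : ∀ u u' : ℕ → ℝ, SeqBox γ u → SeqBox γ u' → ∀ D : ℝ, (∀ j, |u j - u' j| ≤ D) → |B u - B u'| ≤ M * D)
    (hM : 0 ≤ M) (hb : 0 < b) (hp₀ : 0 < p₀) (hp₀γ : p₀ ≤ γ) (hlo : ∀ u, SeqBox γ u → b ≤ B u)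
    (hh₀ : SeqBox γ h₀) (hf₀ : MemFlow B p₀ h₀) :
    Set.InjOn (fun u : ℕ → ℝ => limUnder atTop (fun m => 1 / u m ^ 2 - 1 / h₀ m ^ 2))
      {u | SeqBox γ u ∧ ∃ p, 0 < p ∧ p ≤ γ ∧ MemFlow B p u} := by
  obtain ⟨m₀, hq, hK⟩ := exists_threshold_scale hb M γ
  -- every pair of box solutions has a relative Λ-parameter
  have hlim : ∀ {u v : ℕ → ℝ} {q r : ℝ}, SeqBox γ u → SeqBox γ v → 0 < q → q ≤ γ → 0 < r → r ≤ γ → MemFlow B q u → MemFlow B r v →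
      Tendsto (fun m => 1 / u m ^ 2 - 1 / v m ^ 2) atTop (𝓝 (limUnder atTop (fun m => 1 / u m ^ 2 - 1 / v m ^ 2))) := by
    intro u v q r hu hv hq0 hqγ hr0 hrγ hfu hfv
    obtain ⟨δ, hδ, -⟩ := exists_tendsto_disc_large_init hB hM hq0 hqγ hr0 hrγ hb hlo hu hv hfu hfv hq hK
    exact tendsto_nhds_limUnder ⟨δ, hδ⟩
  intro u hu u' hu' heq
  obtain ⟨q, hq0, hqγ, hfu⟩ := hu.2
  obtain ⟨q', hq0', hqγ', hfu'⟩ := hu'.2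
  have h1 := hlim hu.1 hh₀ hq0 hqγ hp₀ hp₀γ hfu hf₀
  have h2 := hlim hu'.1 hh₀ hq0' hqγ' hp₀ hp₀γ hfu' hf₀
  simp only at heq
  rw [heq] at h1
  -- cocycle: (1/u² − 1/h₀²) − (1/u′² − 1/h₀²) = 1/u² − 1/u′² → 0
  have h3 : Tendsto (fun m => 1 / u m ^ 2 - 1 / u' m ^ 2) atTop (𝓝 0) := by
    have := h1.sub h2
    rw [sub_self] at this
    refine this.congr fun m => ?_
    ring
  exact eq_of_tendsto_disc_zero_two_pins hB hM hb hq0 hqγ hq0' hqγ' hlo hu.1 hu'.1 hfu hfu' h3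

end Summit.QuantumFields.BalabanUV.Beta.EriceRemainderEnclosureHistoryAutonomyFunctionalShiftLargeSeparation

end
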